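/-
Copyright (c) 2026. All rights reserved.
Released under Apache 2.0 license as described in the file LICENSE.
-/
import Literature.NumberTheory.Automorphic.EichlerOrdersGenusTwoSidedIdeals
import HarnessLib

/-!
# The admissible support of a two-sided ideal of an Eichler order is unique: `Idl(O)/ℚ^× ≅ (ℤ/2ℤ)^{ω(N)}` is a bijection,
# and the class of a normaliser element determines its support (Voight (23.4.20), Lemma 18.5.1, Prop. 18.5.3)

[tag: quaternion_algebra] [tag: eichler_order] [tag: class_number]

Topic `NumberTheory/Automorphic`; THEOREMS ONLY (no definition, no named fact, no instance, no notation; net debt `0`).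
Lane `lit-hodgefound`, seat p12, gen 54 — the UNIQUENESS half of Voight (23.4.20) for the Eichler order `O` of a Brandt
setup `S : XiSetup N⁺ N⁻` (definite quaternion algebra `D` over `ℚ` of discriminant `N⁻`, Eichler order of level `N⁺`), on
top of `EichlerOrderTwoSidedIdealsNormaliser.lean` (existence: every two-sided ideal is `ℚ^× · O P_l(O)`, every
`x ∈ N(O)` has `O P_l(O) = (q x) O`) and `BrandtSetupTwoSidedIdealNorms.lean` (local generators, local structure of `O P_l(O)`).

THE PRINTED STATEMENTS (J. Voight, *Quaternion Algebras*, GTM 288). **(23.4.20)** (with 23.3.19 and Prop. 23.4.14): for an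
Eichler order `O` of reduced discriminant `𝔑 = 𝔇𝔐` the sequence `0 → Idl(R) → Idl(O) → ∏_{𝔭 ∣ 𝔑} ℤ/2ℤ → 0` is EXACT — so the
subset `s ⊆ {𝔭 ∣ 𝔑}` with `J = 𝔞 ∏_{𝔭 ∈ s} T_𝔭` is uniquely determined by the two-sided ideal `J`, and `Idl(O)/Idl(R)` has
exactly `2^{ω(𝔑)}` elements. **Lemma 18.5.1 / Prop. 18.5.3**: `N_{B^×}(O)/(F^×O^×) ≅ PIdl(O)/PIdl(R) ≤ Idl(O)/Idl(R)` — the class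
of `α ∈ N(O)` is determined by the admissible support of `OαO`. Locally (Prop. 23.4.14, 23.3.19): `𝔔_{𝔭^e} = Oϖ` with
`nrd ϖ = π^e` and `𝔓 = Oπ`, and NEITHER IS `F_𝔭^× · O_𝔭` (`[Idl(O_𝔭) : Idl(R_𝔭)] = 2`).

With the tree's `T_r(O) = XiSetup.twoSidedIdeal`, `P_l(O) = XiSetup.twoSidedIdealProd` (a LIST `l` of primes), central units
`ν ∈ D^×` with `ν = algebraMap ℚ D q`, and the normaliser condition `x • (op x⁻¹ • O) = O`, this file proves:

* §1 **the local non-triviality `T_r(O)₍r₎ ≠ q · O₍r₎` for every prime `r ∣ N⁺N⁻` and every `q ∈ ℚ^×`**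
  (`XiSetup.localAt_twoSidedIdeal_ne_units_smul`): at a ramified `r` or an odd exponent `e = v_r(N⁺)` the local generator has
  odd valuation `v_r(nrd) ∈ {1, e}` while `v_r(nrd(q u)) = 2 v_r(q)` for a local unit `u`; at an even `e ≥ 2` a central `q ∈ 𝔔₍r₎`
  has `v_r(q) ≥ e` in the level model (`Φ(q) = q · 1` is Atkin–Lehner shaped), against `2 v_r(q) = e`;
* §2 **UNIQUENESS OF THE ADMISSIBLE SUPPORT: `ν · O P_l(O) = ν' · O P_{l'}(O)` (central `ν, ν' ∈ ℚ^×`, `l, l'` duplicate-free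
  lists of primes of `N⁺N⁻`) forces `l ~ l'`** (`XiSetup.perm_of_units_smul_order_mul_twoSidedIdealProd_eq`), and then the
  scalars agree: `k · O P_l(O) = k' · O P_l(O) ⟹ k = k'` (`XiSetup.eq_of_natCast_smul_order_mul_twoSidedIdealProd_eq`); so
  **`O P_l(O)` is a rational multiple of `O` only for `l = []`** and the `2^{ω(N⁺N⁻)}` ideals `O P_s(O)`, `s ⊆` primes of `N⁺N⁻`,
  are pairwise inequivalent modulo `ℚ^×`;
* §3 **(23.4.20) AS A BIJECTION: every two-sided `O`-ideal `J` (`J ∈ rightIdeals O`, `O_L(J) = O`) has a UNIQUE subset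
  `s ⊆ (N⁺N⁻).primeFactors` with `m J = c · O P_{sort s}(O)` for some `m, c ≥ 1`**
  (`XiSetup.existsUnique_finset_smul_eq_smul_order_mul_twoSidedIdealProd`), the ratio `c/m` being unique too;
* §4 **Prop. 18.5.3, well-definedness: for `x ∈ N(O)` the admissible `l` with `O P_l(O) = (q x) O` is unique up to order and
  `q > 0` is unique** (`XiSetup.perm_and_eq_of_order_mul_twoSidedIdealProd_eq_units_smul_of_eq_algebraMap_mul`), packaged as
  `∃! s ⊆ (N⁺N⁻).primeFactors` (`XiSetup.existsUnique_finset_order_mul_twoSidedIdealProd_eq_units_smul_of_conj_eq`); the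
  support is empty iff `x ∈ ℚ^× O^×` (`q x` stabilises `O` for some `q > 0`);
* §5 the same for every left order `O_L(I)` (setup `S.ofLeftOrder hI`).

## References

* [Voight2021] J. Voight, *Quaternion Algebras*, GTM 288 (2021): Lemma 18.5.1, Prop. 18.5.3, 18.5.7, Thm. 18.1.3, 23.3.19,
  Prop. 23.4.14, (23.4.20), Exercise 16.16.
* [VignerasLNM800] M.-F. Vignéras, *Arithmétique des algèbres de quaternions*, LNM 800 (1980), Ch. II §1 Cor. 1.7, Ch. II §2
  (normalisateur d'un ordre d'Eichler), Ch. III §5 exercice 5.8.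

## Scope (honest)

Theorems only; `Idl(O)/ℚ^×` and `N(O)/ℚ^×O^×` are not built as groups — the bijection with subsets of the primes of `N⁺N⁻` is
stated as existence-and-uniqueness of the subset. The group law (symmetric difference of supports) is not in this file.
-/

noncomputable section

open scoped Pointwise

universe u

namespace Literature.NumberTheory.Automorphic

open AtkinLehner

namespace Brandt

variable {Nplus Nminus : ℕ} (S : XiSetup Nplus Nminus)

/-! ## §0 Elementary lemmas -/

/-- The algebra of a setup is a division algebra. [folklore] -/
private theorem XiSetup.hdiv₆₀ : ∀ x : S.D, x ≠ 0 → IsUnit x :=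
  fun _ hx => isUnit_of_isTotallyDefinite S.D S.isTotallyDefinite hx

/-- The reduced norm of a unit is non-zero. [folklore] -/
private theorem XiSetup.reducedNorm_units_ne_zero₆₀ (u : S.Dˣ) : reducedNorm ℚ S.D (u : S.D) ≠ 0 :=
  (isUnit_iff_reducedNorm_ne_zero_holds ℚ S.D (u : S.D)).mp u.isUnit

/-- A central unit `ν = n · 1` acts as the integer `n`: `ν J = n J`. [folklore] -/
private theorem units_smul_eq_natCast_smul₆₀ {D : Type u} [Ring D] {ν : Dˣ} {n : ℕ} (hν : (ν : D) = (n : ℤ))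
    (J : Submodule ℤ D) : ν • J = (n : ℤ) • J := by
  ext x
  constructor
  · intro hx
    obtain ⟨y, hy, rfl⟩ := exists_eq_zsmul_of_mem_units_smul hν hx
    exact Submodule.smul_mem_pointwise_smul y _ J hy
  · intro hx
    obtain ⟨y, hy, rfl⟩ := (Submodule.mem_smul_pointwise_iff_exists x _ J).mp hx
    exact units_smul_eq_zsmul_of_val_eq hν J hy

/-- A central unit `ν = k · 1`, `k ∈ ℕ`, is `algebraMap ℚ D k`. [folklore] -/
private theorem val_eq_algebraMap_of_val_eq_natCast₆₀ {D : Type u} [Ring D] [Algebra ℚ D] {ν : Dˣ} {k : ℕ}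
    (hν : (ν : D) = (k : ℤ)) : (ν : D) = algebraMap ℚ D (k : ℚ) := by
  rw [map_natCast, hν, Int.cast_natCast]

/-- `ν⁻¹ ν'` for central units `ν = q · 1`, `ν' = q' · 1` is `(q'/q) · 1`. [folklore] -/
private theorem val_inv_mul_eq_algebraMap₆₀ {D : Type u} [Ring D] [Algebra ℚ D] {q q' : ℚ} (hq : q ≠ 0) {ν ν' : Dˣ}
    (hν : (ν : D) = algebraMap ℚ D q) (hν' : (ν' : D) = algebraMap ℚ D q') :
    ((ν⁻¹ * ν' : Dˣ) : D) = algebraMap ℚ D (q' / q) := by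
  have hinv : ((ν⁻¹ : Dˣ) : D) = algebraMap ℚ D q⁻¹ :=
    Units.inv_eq_of_mul_eq_one_right (by rw [hν, ← map_mul, mul_inv_cancel₀ hq, map_one])
  rw [Units.val_mul, hinv, hν', ← map_mul, inv_mul_eq_div]

/-- A unit lies in its own translate of an order-like lattice containing `1`: `ν ∈ ν M` when `1 ∈ M`. [folklore] -/
private theorem units_val_mem_smul₆₀ {D : Type u} [Ring D] (ν : Dˣ) {M : Submodule ℤ D} (hM : (1 : D) ∈ M) :
    (ν : D) ∈ ν • M := by
  have h := Submodule.smul_mem_pointwise_smul (1 : D) ν M hM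
  rwa [Units.smul_def, smul_eq_mul, mul_one] at h

/-- A unit `ν = q · 1` has `q ≠ 0` (`nrd ν = q² ≠ 0`). [folklore] -/
private theorem XiSetup.ne_zero_of_val_eq_algebraMap₆₀ {q : ℚ} {ν : S.Dˣ} (hν : (ν : S.D) = algebraMap ℚ S.D q) : q ≠ 0 :=
  fun h0 => S.reducedNorm_units_ne_zero₆₀ ν (by rw [hν, h0, map_zero, reducedNorm_apply_zero])

/-- Two finite sets of naturals whose increasing enumerations are permutations of each other are equal. [folklore] -/
private theorem finset_eq_of_perm_sort₆₀ {s s' : Finset ℕ} (h : (s.sort (· ≤ ·)).Perm (s'.sort (· ≤ ·))) : s = s' := by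
  ext r
  constructor
  · intro hr; exact (Finset.mem_sort _).mp (h.mem_iff.mp ((Finset.mem_sort _).mpr hr))
  · intro hr; exact (Finset.mem_sort _).mp (h.mem_iff.mpr ((Finset.mem_sort _).mpr hr))

/-- `v_r(nrd(a⁻¹ b)) = v_r(nrd b) − v_r(nrd a)`. [folklore] -/
private theorem XiSetup.padicValRat_reducedNorm_inv_mul₆₀ {r : ℕ} [Fact r.Prime] (a b : S.Dˣ) :
    padicValRat r (reducedNorm ℚ S.D ((a⁻¹ * b : S.Dˣ) : S.D)) =
      padicValRat r (reducedNorm ℚ S.D (b : S.D)) - padicValRat r (reducedNorm ℚ S.D (a : S.D)) := by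
  rw [Units.val_mul, reducedNorm_mul_holds ℚ S.D, reducedNorm_units_inv,
    padicValRat.mul (inv_ne_zero (S.reducedNorm_units_ne_zero₆₀ a)) (S.reducedNorm_units_ne_zero₆₀ b), padicValRat.inv]
  ring

/-- `v_r(nrd(a b)) = v_r(nrd a) + v_r(nrd b)`. [folklore] -/
private theorem XiSetup.padicValRat_reducedNorm_mul₆₀ {r : ℕ} [Fact r.Prime] (a b : S.Dˣ) :
    padicValRat r (reducedNorm ℚ S.D ((a * b : S.Dˣ) : S.D)) =
      padicValRat r (reducedNorm ℚ S.D (a : S.D)) + padicValRat r (reducedNorm ℚ S.D (b : S.D)) := by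
  rw [Units.val_mul, reducedNorm_mul_holds ℚ S.D,
    padicValRat.mul (S.reducedNorm_units_ne_zero₆₀ a) (S.reducedNorm_units_ne_zero₆₀ b)]

/-- `v_r(nrd(q · 1)) = 2 v_r(q)` for a central unit. [folklore] -/
private theorem XiSetup.padicValRat_reducedNorm_central₆₀ {r : ℕ} [Fact r.Prime] {q : ℚ} (hq : q ≠ 0) {ν : S.Dˣ}
    (hν : (ν : S.D) = algebraMap ℚ S.D q) : padicValRat r (reducedNorm ℚ S.D (ν : S.D)) = 2 * padicValRat r q := by
  rw [hν, reducedNorm_algebraMap_rat, pow_two, padicValRat.mul hq hq]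
  ring

/-- The local lattice `(if r ∈ l then T_r(O) else O)₍r₎` is principal: `= g O₍r₎` with `v_r(nrd g)` known. [cite: Voight2021, 23.3.19 and Prop. 23.4.14] -/
private theorem XiSetup.exists_localAt_ite_eq_units_smul₆₀ {r : ℕ} [Fact r.Prime] (l : List ℕ) :
    ∃ g : S.Dˣ, localAt r (if r ∈ l then S.twoSidedIdeal S.O r else S.O) = g • localAt r S.O := by
  by_cases hm : r ∈ l
  · obtain ⟨g, -, hg, -⟩ := S.exists_generator_twoSidedIdeal (r := r)
    exact ⟨g, by rw [if_pos hm, hg]⟩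
  · exact ⟨1, by rw [if_neg hm, one_smul]⟩

/-! ## §1 The admissible ideal is locally never a rational multiple of the order -/

/-- **`T_r(O)₍r₎ ≠ q · O₍r₎` for every prime `r ∣ N⁺N⁻` and every `q ∈ ℚ^×`** (`ν = q · 1`): the local two-sided ideal
`𝔓_r` (ramified `r`) resp. `𝔔_{r^e}` (`e = v_r(N⁺) ≥ 1`) of the Eichler order is NOT in `ℚ_r^× · O_r` — the non-trivial
element of `Idl(O_r)/Idl(ℤ_r) ≅ ℤ/2ℤ`. Ramified or odd `e`: a local generator has odd `v_r(nrd) ∈ {1, e}`, a rational multiple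
of a local unit has even valuation; even `e ≥ 2`: a central `q ∈ 𝔔₍r₎` has `Φ(q) = q · 1` Atkin–Lehner shaped, so `v_r(q) ≥ e`,
contradicting `2 v_r(q) = e`. [cite: Voight2021, Thm. 18.1.3 with 23.3.19, Prop. 23.4.14 and (23.4.20)] [cite: VignerasLNM800, Ch. II §1 Cor. 1.7 and Ch. II §2] -/
theorem XiSetup.localAt_twoSidedIdeal_ne_units_smul {r : ℕ} (hr : r.Prime) (hrN : r ∣ Nplus * Nminus) {q : ℚ} (hq : q ≠ 0)
    {ν : S.Dˣ} (hν : (ν : S.D) = algebraMap ℚ S.D q) :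
    localAt r (S.twoSidedIdeal S.O r) ≠ ν • localAt r S.O := by
  haveI : Fact r.Prime := ⟨hr⟩
  have hO := S.isZOrder_O
  intro h
  obtain ⟨g, -, hg, hvg⟩ := S.exists_generator_twoSidedIdeal (r := r)
  -- `ν⁻¹ g` stabilises `O₍r₎`, so `a_r = 2 v_r(q)`
  have hst : ν⁻¹ * g ∈ MulAction.stabilizer S.Dˣ (localAt r S.O) :=
    (units_smul_localAt_eq_iff (O := S.O)).mp (hg.symm.trans h)
  have hval := S.padicValRat_reducedNorm_eq_zero_of_mem_stabilizer hO hst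
  rw [S.padicValRat_reducedNorm_inv_mul₆₀, hvg, S.padicValRat_reducedNorm_central₆₀ hq hν] at hval
  by_cases hm : r ∣ Nminus
  · rw [if_pos hm] at hval
    omega
  · rw [if_neg hm] at hval
    have hrNp : r ∣ Nplus := ((Nat.Prime.dvd_mul hr).mp hrN).resolve_right hm
    have he : 0 < Nplus.factorization r := hr.factorization_pos_of_dvd S.nplus_ne_zero hrNp
    obtain ⟨Φ, hΦ⟩ := S.exists_isLevelShape_iff S.nplus_ne_zero hm
    have hmem : (ν : S.D) ∈ localAt r (atkinLehnerIdeal S.O (r ^ Nplus.factorization r)) := by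
      rw [← S.twoSidedIdeal_of_not_dvd S.O hm, h]
      exact units_val_mem_smul₆₀ ν (le_localAt r S.O hO.one_mem)
    have h00 := ((mem_localAt_atkinLehnerIdeal_iff Φ hO hΦ (ν : S.D)).mp hmem).1
    rw [hν, AlgHom.commutes, Matrix.algebraMap_matrix_apply, if_pos rfl,
      show algebraMap ℚ ℚ_[r] q = ((q : ℚ) : ℚ_[r]) from rfl, Padic.norm_ratCast_eq_zpow hq] at h00
    have hp1 : (1 : ℝ) < r := by exact_mod_cast hr.one_lt
    have hle := (zpow_le_zpow_iff_right₀ hp1).mp h00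
    omega

/-- The same at the left order `O_L(I)` of any right `O`-ideal `I` (setup `S.ofLeftOrder hI`).
[cite: Voight2021, Thm. 18.1.3 with 23.3.19, Prop. 23.4.14 and (23.4.20)] -/
theorem XiSetup.localAt_twoSidedIdeal_leftOrder_ne_units_smul {I : Submodule ℤ S.D} (hI : I ∈ rightIdeals S.O) {r : ℕ}
    (hr : r.Prime) (hrN : r ∣ Nplus * Nminus) {q : ℚ} (hq : q ≠ 0) {ν : S.Dˣ} (hν : (ν : S.D) = algebraMap ℚ S.D q) :
    localAt r (S.twoSidedIdeal (leftOrder I) r) ≠ ν • localAt r (leftOrder I) :=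
  (S.ofLeftOrder hI).localAt_twoSidedIdeal_ne_units_smul hr hrN hq hν

/-! ## §2 Uniqueness of the admissible support and of the scalar -/

/-- **One inclusion of the supports: if `ν · O P_l(O) = ν' · O P_{l'}(O)` with central `ν = q · 1`, `ν' = q' · 1` (`q ≠ 0`),
`l` a duplicate-free list of primes of `N⁺N⁻` and `l'` a duplicate-free list of primes, then every `r ∈ l` lies in `l'`**
(localise at `r`: otherwise `T_r(O)₍r₎ = (q'/q) O₍r₎`, excluded by §1). [cite: Voight2021, (23.4.20) (exactness at `Idl(O)`)] -/
theorem XiSetup.mem_of_mem_of_units_smul_order_mul_twoSidedIdealProd_eq {l l' : List ℕ}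
    (hl : ∀ r ∈ l, r.Prime ∧ r ∣ Nplus * Nminus) (hnd : l.Nodup) (hl' : ∀ r ∈ l', r.Prime) (hnd' : l'.Nodup)
    {q q' : ℚ} (hq : q ≠ 0) {ν ν' : S.Dˣ} (hν : (ν : S.D) = algebraMap ℚ S.D q) (hν' : (ν' : S.D) = algebraMap ℚ S.D q')
    (h : ν • (S.O * S.twoSidedIdealProd S.O l) = ν' • (S.O * S.twoSidedIdealProd S.O l')) {r : ℕ} (hr : r ∈ l) :
    r ∈ l' := by
  by_contra hrl'
  obtain ⟨hrp, hrN⟩ := hl r hr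
  haveI : Fact r.Prime := ⟨hrp⟩
  have hO := S.isZOrder_O
  have hloc := congrArg (localAt r) h
  rw [localAt_units_smul, localAt_units_smul, S.localAt_order_mul_twoSidedIdealProd hO (fun r h => (hl r h).1) hnd hrp,
    if_pos hr, S.localAt_order_mul_twoSidedIdealProd hO hl' hnd' hrp, if_neg hrl'] at hloc
  have key : localAt r (S.twoSidedIdeal S.O r) = (ν⁻¹ * ν') • localAt r S.O := by
    rw [mul_smul, ← hloc, inv_smul_smul]
  exact S.localAt_twoSidedIdeal_ne_units_smul hrp hrN (div_ne_zero (S.ne_zero_of_val_eq_algebraMap₆₀ hν') hq)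
    (val_inv_mul_eq_algebraMap₆₀ hq hν hν') key

/-- **UNIQUENESS OF THE ADMISSIBLE SUPPORT ((23.4.20) is injective on `∏_{r ∣ N} ℤ/2ℤ`): `ν · O P_l(O) = ν' · O P_{l'}(O)` with
central `ν, ν' ∈ ℚ^×` and `l, l'` duplicate-free lists of primes of `N⁺N⁻` forces `l ~ l'`.** [cite: Voight2021, (23.4.20)] [cite: VignerasLNM800, Ch. III §5 exercice 5.8] -/
theorem XiSetup.perm_of_units_smul_order_mul_twoSidedIdealProd_eq {l l' : List ℕ}
    (hl : ∀ r ∈ l, r.Prime ∧ r ∣ Nplus * Nminus) (hnd : l.Nodup) (hl' : ∀ r ∈ l', r.Prime ∧ r ∣ Nplus * Nminus) (hnd' : l'.Nodup)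
    {q q' : ℚ} (hq : q ≠ 0) (hq' : q' ≠ 0) {ν ν' : S.Dˣ} (hν : (ν : S.D) = algebraMap ℚ S.D q)
    (hν' : (ν' : S.D) = algebraMap ℚ S.D q')
    (h : ν • (S.O * S.twoSidedIdealProd S.O l) = ν' • (S.O * S.twoSidedIdealProd S.O l')) : l.Perm l' :=
  (List.perm_ext_iff_of_nodup hnd hnd').mpr fun _ =>
    ⟨S.mem_of_mem_of_units_smul_order_mul_twoSidedIdealProd_eq hl hnd (fun r h => (hl' r h).1) hnd' hq hν hν' h,
      S.mem_of_mem_of_units_smul_order_mul_twoSidedIdealProd_eq hl' hnd' (fun r h => (hl r h).1) hnd hq' hν' hν h.symm⟩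

/-- **Integer form: `k · O P_l(O) = k' · O P_{l'}(O)` (`k, k' ≥ 1`) forces `l ~ l'`.** [cite: Voight2021, (23.4.20)] -/
theorem XiSetup.perm_of_natCast_smul_order_mul_twoSidedIdealProd_eq {l l' : List ℕ}
    (hl : ∀ r ∈ l, r.Prime ∧ r ∣ Nplus * Nminus) (hnd : l.Nodup) (hl' : ∀ r ∈ l', r.Prime ∧ r ∣ Nplus * Nminus) (hnd' : l'.Nodup)
    {k k' : ℕ} (hk : k ≠ 0) (hk' : k' ≠ 0)
    (h : (k : ℤ) • (S.O * S.twoSidedIdealProd S.O l) = (k' : ℤ) • (S.O * S.twoSidedIdealProd S.O l')) : l.Perm l' := by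
  obtain ⟨ν, hν, -⟩ := exists_units_val_eq_natCast (D := S.D) hk
  obtain ⟨ν', hν', -⟩ := exists_units_val_eq_natCast (D := S.D) hk'
  rw [← units_smul_eq_natCast_smul₆₀ hν, ← units_smul_eq_natCast_smul₆₀ hν'] at h
  exact S.perm_of_units_smul_order_mul_twoSidedIdealProd_eq hl hnd hl' hnd' (by exact_mod_cast hk) (by exact_mod_cast hk')
    (val_eq_algebraMap_of_val_eq_natCast₆₀ hν) (val_eq_algebraMap_of_val_eq_natCast₆₀ hν') h

/-- **The valuations of the scalar are determined: `ν · O P_l(O) = ν' · O P_l(O)` with central `ν = q · 1`, `ν' = q' · 1`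
forces `v_r(q) = v_r(q')` at every prime `r`** (both sides are locally principal; the quotient of the generators is a local
unit of valuation `2 (v_r q − v_r q')`). [cite: Voight2021, (23.4.20) (injectivity of `Idl(R) → Idl(O)`) and Lemma 18.5.1] -/
theorem XiSetup.padicValRat_eq_of_units_smul_order_mul_twoSidedIdealProd_eq {l : List ℕ} (hl : ∀ r ∈ l, r.Prime) (hnd : l.Nodup)
    {q q' : ℚ} (hq : q ≠ 0) (hq' : q' ≠ 0) {ν ν' : S.Dˣ} (hν : (ν : S.D) = algebraMap ℚ S.D q)
    (hν' : (ν' : S.D) = algebraMap ℚ S.D q')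
    (h : ν • (S.O * S.twoSidedIdealProd S.O l) = ν' • (S.O * S.twoSidedIdealProd S.O l)) {r : ℕ} (hr : r.Prime) :
    padicValRat r q = padicValRat r q' := by
  haveI : Fact r.Prime := ⟨hr⟩
  have hO := S.isZOrder_O
  have hloc := congrArg (localAt r) h
  rw [localAt_units_smul, localAt_units_smul, S.localAt_order_mul_twoSidedIdealProd hO hl hnd hr] at hloc
  obtain ⟨g, hg⟩ := S.exists_localAt_ite_eq_units_smul₆₀ (r := r) l
  rw [hg, ← mul_smul, ← mul_smul] at hloc
  have hval := S.padicValRat_reducedNorm_eq_zero_of_mem_stabilizer hO ((units_smul_localAt_eq_iff (O := S.O)).mp hloc)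
  rw [S.padicValRat_reducedNorm_inv_mul₆₀, S.padicValRat_reducedNorm_mul₆₀, S.padicValRat_reducedNorm_mul₆₀,
    S.padicValRat_reducedNorm_central₆₀ hq hν, S.padicValRat_reducedNorm_central₆₀ hq' hν'] at hval
  linarith

/-- **UNIQUENESS OF THE SCALAR: `k · O P_l(O) = k' · O P_l(O)` (`k, k' ≥ 1`) forces `k = k'`.** [cite: Voight2021, (23.4.20)] -/
theorem XiSetup.eq_of_natCast_smul_order_mul_twoSidedIdealProd_eq {l : List ℕ} (hl : ∀ r ∈ l, r.Prime) (hnd : l.Nodup)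
    {k k' : ℕ} (hk : k ≠ 0) (hk' : k' ≠ 0)
    (h : (k : ℤ) • (S.O * S.twoSidedIdealProd S.O l) = (k' : ℤ) • (S.O * S.twoSidedIdealProd S.O l)) : k = k' := by
  obtain ⟨ν, hν, -⟩ := exists_units_val_eq_natCast (D := S.D) hk
  obtain ⟨ν', hν', -⟩ := exists_units_val_eq_natCast (D := S.D) hk'
  rw [← units_smul_eq_natCast_smul₆₀ hν, ← units_smul_eq_natCast_smul₆₀ hν'] at h
  refine (Nat.eq_iff_prime_padicValNat_eq k k' hk hk').mpr fun r hr => ?_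
  haveI : Fact r.Prime := ⟨hr⟩
  have key := S.padicValRat_eq_of_units_smul_order_mul_twoSidedIdealProd_eq hl hnd (q := k) (q' := k') (by exact_mod_cast hk)
    (by exact_mod_cast hk') (val_eq_algebraMap_of_val_eq_natCast₆₀ hν) (val_eq_algebraMap_of_val_eq_natCast₆₀ hν') h hr
  rw [padicValRat.of_nat, padicValRat.of_nat] at key
  exact_mod_cast key

/-- **Both at once: `k · O P_l(O) = k' · O P_{l'}(O)` forces `l ~ l'` and `k = k'`** — the pair (scalar, admissible support) of a
two-sided ideal is unique. [cite: Voight2021, (23.4.20)] -/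
theorem XiSetup.perm_and_eq_of_natCast_smul_order_mul_twoSidedIdealProd_eq {l l' : List ℕ}
    (hl : ∀ r ∈ l, r.Prime ∧ r ∣ Nplus * Nminus) (hnd : l.Nodup) (hl' : ∀ r ∈ l', r.Prime ∧ r ∣ Nplus * Nminus) (hnd' : l'.Nodup)
    {k k' : ℕ} (hk : k ≠ 0) (hk' : k' ≠ 0)
    (h : (k : ℤ) • (S.O * S.twoSidedIdealProd S.O l) = (k' : ℤ) • (S.O * S.twoSidedIdealProd S.O l')) : l.Perm l' ∧ k = k' := by
  have hperm := S.perm_of_natCast_smul_order_mul_twoSidedIdealProd_eq hl hnd hl' hnd' hk hk' h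
  refine ⟨hperm, S.eq_of_natCast_smul_order_mul_twoSidedIdealProd_eq (fun r h => (hl r h).1) hnd hk hk' ?_⟩
  rwa [← S.twoSidedIdealProd_perm S.isZOrder_O (fun r h => (hl r h).1) hperm] at h

/-- **`O P_l(O)` is a rational multiple of `O` only for the empty list**: `O P_l(O) ≠ ν · O` for `l ≠ []` a duplicate-free list
of primes of `N⁺N⁻` and every central `ν = q · 1`. [cite: Voight2021, (23.4.20)] -/
theorem XiSetup.order_mul_twoSidedIdealProd_ne_units_smul_order {l : List ℕ} (hl : ∀ r ∈ l, r.Prime ∧ r ∣ Nplus * Nminus)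
    (hnd : l.Nodup) (hne : l ≠ []) {q : ℚ} {ν : S.Dˣ} (hν : (ν : S.D) = algebraMap ℚ S.D q) :
    S.O * S.twoSidedIdealProd S.O l ≠ ν • S.O := by
  intro h
  have hq : q ≠ 0 := S.ne_zero_of_val_eq_algebraMap₆₀ hν
  have h1 : (1 : S.Dˣ) • (S.O * S.twoSidedIdealProd S.O l) = ν • (S.O * S.twoSidedIdealProd S.O []) := by
    rw [one_smul, h, S.twoSidedIdealProd_nil, mul_one]
  obtain ⟨r, hr⟩ := List.exists_mem_of_ne_nil l hne
  exact List.not_mem_nil (S.mem_of_mem_of_units_smul_order_mul_twoSidedIdealProd_eq hl hnd (l' := []) (by simp) List.nodup_nil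
    one_ne_zero (by rw [Units.val_one, map_one]) hν h1 hr)

/-- In particular **`O P_l(O) ≠ O`** and **`O P_l(O) ≠ k · O`** for `l ≠ []`. [cite: Voight2021, (23.4.20)] -/
theorem XiSetup.order_mul_twoSidedIdealProd_ne_natCast_smul_order {l : List ℕ} (hl : ∀ r ∈ l, r.Prime ∧ r ∣ Nplus * Nminus)
    (hnd : l.Nodup) (hne : l ≠ []) {k : ℕ} (hk : k ≠ 0) : S.O * S.twoSidedIdealProd S.O l ≠ (k : ℤ) • S.O := by
  obtain ⟨ν, hν, -⟩ := exists_units_val_eq_natCast (D := S.D) hk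
  rw [← units_smul_eq_natCast_smul₆₀ hν]
  exact S.order_mul_twoSidedIdealProd_ne_units_smul_order hl hnd hne (val_eq_algebraMap_of_val_eq_natCast₆₀ hν)

/-- `O P_l(O) ≠ O` for `l ≠ []`: a non-empty admissible product is a PROPER two-sided ideal. [cite: Voight2021, (23.4.20)] -/
theorem XiSetup.order_mul_twoSidedIdealProd_ne_order {l : List ℕ} (hl : ∀ r ∈ l, r.Prime ∧ r ∣ Nplus * Nminus)
    (hnd : l.Nodup) (hne : l ≠ []) : S.O * S.twoSidedIdealProd S.O l ≠ S.O := by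
  have h := S.order_mul_twoSidedIdealProd_ne_natCast_smul_order hl hnd hne one_ne_zero
  rwa [Nat.cast_one, one_smul] at h

/-! ## §3 (23.4.20) as a bijection with the subsets of the primes of `N⁺N⁻` -/

/-- The increasing enumeration of a set of primes of `N⁺N⁻` is an admissible duplicate-free list. [folklore] -/
private theorem sort_admissible₆₀ {s : Finset ℕ} (hs : s ⊆ (Nplus * Nminus).primeFactors) :
    (∀ r ∈ s.sort (· ≤ ·), r.Prime ∧ r ∣ Nplus * Nminus) ∧ (s.sort (· ≤ ·)).Nodup :=
  ⟨fun r hr => by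
    have h := Nat.mem_primeFactors.mp (hs ((Finset.mem_sort _).mp hr))
    exact ⟨h.1, h.2.1⟩, Finset.sort_nodup _ _⟩

/-- A duplicate-free list is a permutation of the increasing enumeration of its set of members. [folklore] -/
private theorem perm_sort_toFinset₆₀ {l : List ℕ} (hnd : l.Nodup) : l.Perm (l.toFinset.sort (· ≤ ·)) :=
  (List.perm_ext_iff_of_nodup hnd (Finset.sort_nodup _ _)).mpr fun r => by rw [Finset.mem_sort, List.mem_toFinset]

/-- **TWO SUBSETS WITH EQUIVALENT PRODUCTS ARE EQUAL: `k · O P_{sort s}(O) = k' · O P_{sort s'}(O)` forces `s = s'` (and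
`k = k'`)** for `s, s' ⊆ (N⁺N⁻).primeFactors — the `2^{ω(N⁺N⁻)}` ideals `O P_s(O)` are pairwise inequivalent modulo `ℚ^×`.
[cite: Voight2021, (23.4.20)] -/
theorem XiSetup.finset_eq_of_natCast_smul_order_mul_twoSidedIdealProd_sort_eq {s s' : Finset ℕ}
    (hs : s ⊆ (Nplus * Nminus).primeFactors) (hs' : s' ⊆ (Nplus * Nminus).primeFactors) {k k' : ℕ} (hk : k ≠ 0) (hk' : k' ≠ 0)
    (h : (k : ℤ) • (S.O * S.twoSidedIdealProd S.O (s.sort (· ≤ ·))) = (k' : ℤ) • (S.O * S.twoSidedIdealProd S.O (s'.sort (· ≤ ·)))) :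
    s = s' ∧ k = k' := by
  obtain ⟨hl, hnd⟩ := sort_admissible₆₀ hs
  obtain ⟨hl', hnd'⟩ := sort_admissible₆₀ hs'
  obtain ⟨hperm, hk⟩ := S.perm_and_eq_of_natCast_smul_order_mul_twoSidedIdealProd_eq hl hnd hl' hnd' hk hk' h
  exact ⟨finset_eq_of_perm_sort₆₀ hperm, hk⟩

/-- **(23.4.20) AS A BIJECTION `Idl(O)/ℚ^× ≅ 𝒫(primes of N⁺N⁻)`: every two-sided `O`-ideal `J` (a right `O`-ideal with
`O_L(J) = O`) determines a UNIQUE subset `s` of the primes of `N⁺N⁻` with `m J = c · O P_{sort s}(O)` for some integers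
`m, c ≥ 1`.** Existence is `EichlerOrderTwoSidedIdealsNormaliser`'s global (23.4.20); uniqueness is §2. [cite: Voight2021, (23.4.20)] [cite: VignerasLNM800, Ch. III §5 exercice 5.8] -/
theorem XiSetup.existsUnique_finset_smul_eq_smul_order_mul_twoSidedIdealProd {J : Submodule ℤ S.D} (hJ : J ∈ rightIdeals S.O)
    (hJL : leftOrder J = S.O) :
    ∃! s : Finset ℕ, s ⊆ (Nplus * Nminus).primeFactors ∧ ∃ m c : ℕ, m ≠ 0 ∧ c ≠ 0 ∧
      (m : ℤ) • J = (c : ℤ) • (S.O * S.twoSidedIdealProd S.O (s.sort (· ≤ ·))) := by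
  have hO := S.isZOrder_O
  have hN0 : Nplus * Nminus ≠ 0 := mul_ne_zero S.nplus_ne_zero S.squarefree.ne_zero
  obtain ⟨m, c, hm, hc, l, hnd, hl, h⟩ := S.exists_smul_eq_smul_order_mul_twoSidedIdealProd_of_leftOrder_eq hJ hJL
  have hsub : l.toFinset ⊆ (Nplus * Nminus).primeFactors := fun r hr => by
    obtain ⟨hp, hd⟩ := hl r (List.mem_toFinset.mp hr)
    exact Nat.mem_primeFactors.mpr ⟨hp, hd, hN0⟩
  refine ⟨l.toFinset, ⟨hsub, m, c, hm, hc, ?_⟩, fun s' ⟨hs', m', c', hm', hc', h'⟩ => ?_⟩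
  · rwa [← S.twoSidedIdealProd_perm hO (fun r h => (hl r h).1) (perm_sort_toFinset₆₀ hnd)]
  · -- `(m' c) · O P_{sort s'}… = (m c') · O P_{sort (l.toFinset)}`
    rw [S.twoSidedIdealProd_perm hO (fun r h => (hl r h).1) (perm_sort_toFinset₆₀ hnd)] at h
    have key : ((m * c' : ℕ) : ℤ) • (S.O * S.twoSidedIdealProd S.O (s'.sort (· ≤ ·))) =
        ((m' * c : ℕ) : ℤ) • (S.O * S.twoSidedIdealProd S.O (l.toFinset.sort (· ≤ ·))) := by
      rw [Nat.cast_mul, Nat.cast_mul, mul_smul, ← h', smul_comm, h, ← mul_smul]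
    exact (S.finset_eq_of_natCast_smul_order_mul_twoSidedIdealProd_sort_eq hs' hsub (mul_ne_zero hm hc') (mul_ne_zero hm' hc)
      key).1

/-- **The ratio `c/m` is unique too**: two presentations `m J = c · O P_l(O)`, `m' J = c' · O P_{l'}(O)` of the same two-sided
ideal have `l ~ l'` and `c m' = c' m`. [cite: Voight2021, (23.4.20)] -/
theorem XiSetup.perm_and_mul_eq_mul_of_smul_eq_smul_order_mul_twoSidedIdealProd {J : Submodule ℤ S.D} {l l' : List ℕ}
    (hl : ∀ r ∈ l, r.Prime ∧ r ∣ Nplus * Nminus) (hnd : l.Nodup) (hl' : ∀ r ∈ l', r.Prime ∧ r ∣ Nplus * Nminus) (hnd' : l'.Nodup)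
    {m c m' c' : ℕ} (hm : m ≠ 0) (hc : c ≠ 0) (hm' : m' ≠ 0) (hc' : c' ≠ 0)
    (h : (m : ℤ) • J = (c : ℤ) • (S.O * S.twoSidedIdealProd S.O l)) (h' : (m' : ℤ) • J = (c' : ℤ) • (S.O * S.twoSidedIdealProd S.O l')) :
    l.Perm l' ∧ c * m' = c' * m := by
  have key : ((m' * c : ℕ) : ℤ) • (S.O * S.twoSidedIdealProd S.O l) = ((m * c' : ℕ) : ℤ) • (S.O * S.twoSidedIdealProd S.O l') := by
    rw [Nat.cast_mul, Nat.cast_mul, mul_smul, ← h, smul_comm, h', ← mul_smul]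
  obtain ⟨hperm, hk⟩ := S.perm_and_eq_of_natCast_smul_order_mul_twoSidedIdealProd_eq hl hnd hl' hnd' (mul_ne_zero hm' hc)
    (mul_ne_zero hm hc') key
  exact ⟨hperm, by rw [mul_comm c m', hk, mul_comm]⟩

/-! ## §4 Prop. 18.5.3: the support and the scalar of a normaliser element are well defined -/

/-- **THE CLASS OF `x ∈ N(O)` DETERMINES ITS ADMISSIBLE SUPPORT: if `O P_l(O) = y O` and `O P_{l'}(O) = y' O` with `y = q x`,
`y' = q' x` rational multiples (`q, q' > 0`) of the same `x`, then `l ~ l'` and `q = q'`** (`l, l'` duplicate-free lists of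
primes of `N⁺N⁻`). `l ~ l'`: `O P_{l'}(O) = (q'/q) · O P_l(O)` and §2; `q = q'`: `nrd y = ∏_{r ∈ l} localNorm r = nrd y'` and
`nrd y = q² nrd x`. This is the well-definedness of `N(O)/ℚ^×O^× → Idl(O)/Idl(ℤ)`, `x ↦ OxO`. [cite: Voight2021, Lemma 18.5.1 and Prop. 18.5.3] -/
theorem XiSetup.perm_and_eq_of_order_mul_twoSidedIdealProd_eq_units_smul_of_eq_algebraMap_mul {x y y' : S.Dˣ} {l l' : List ℕ}
    (hl : ∀ r ∈ l, r.Prime ∧ r ∣ Nplus * Nminus) (hnd : l.Nodup) (hl' : ∀ r ∈ l', r.Prime ∧ r ∣ Nplus * Nminus) (hnd' : l'.Nodup)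
    {q q' : ℚ} (hq : 0 < q) (hq' : 0 < q') (hy : (y : S.D) = algebraMap ℚ S.D q * x) (hy' : (y' : S.D) = algebraMap ℚ S.D q' * x)
    (h : S.O * S.twoSidedIdealProd S.O l = y • S.O) (h' : S.O * S.twoSidedIdealProd S.O l' = y' • S.O) :
    l.Perm l' ∧ q = q' := by
  -- the central unit `μ = (q'/q) · 1` with `y' = μ y`
  have hμu : IsUnit (algebraMap ℚ S.D (q' / q)) := (IsUnit.mk0 _ (div_ne_zero hq'.ne' hq.ne')).map _
  set μ : S.Dˣ := hμu.unit with hμ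
  have hμv : (μ : S.D) = algebraMap ℚ S.D (q' / q) := hμu.unit_spec
  have hyμ : y' = μ * y := by
    ext
    rw [Units.val_mul, hμv, hy', hy, ← mul_assoc, ← map_mul, div_mul_cancel₀ _ hq.ne']
  have hperm : l.Perm l' := by
    refine (S.perm_of_units_smul_order_mul_twoSidedIdealProd_eq hl hnd hl' hnd' (div_ne_zero hq'.ne' hq.ne') one_ne_zero hμv
      (ν' := 1) (by rw [Units.val_one, map_one]) ?_)
    rw [one_smul, h', h, hyμ, mul_smul]
  refine ⟨hperm, ?_⟩
  -- norms: `q² nrd x = ∏ localNorm = q'² nrd x`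
  have hn := S.reducedNorm_eq_of_order_mul_twoSidedIdealProd_eq_units_smul (fun r h => (hl r h).1) hnd h
  have hn' := S.reducedNorm_eq_of_order_mul_twoSidedIdealProd_eq_units_smul (fun r h => (hl' r h).1) hnd' h'
  rw [(hperm.map (localNorm Nplus Nminus)).prod_eq, ← hn', hy, hy', reducedNorm_mul_holds ℚ S.D, reducedNorm_mul_holds ℚ S.D,
    reducedNorm_algebraMap_rat, reducedNorm_algebraMap_rat] at hn
  have hx : reducedNorm ℚ S.D (x : S.D) ≠ 0 := S.reducedNorm_units_ne_zero₆₀ x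
  have hsq : q ^ 2 = q' ^ 2 := mul_right_cancel₀ hx hn
  exact (sq_eq_sq₀ hq.le hq'.le).mp hsq

/-- **Prop. 18.5.3 AS EXISTENCE-AND-UNIQUENESS: every `x` in the normaliser of `O` (`x O x⁻¹ = O`) has a UNIQUE subset `s` of the
primes of `N⁺N⁻` such that `O P_{sort s}(O) = (q x) O` for some rational `q > 0`** — the injection
`N(O)/ℚ^×O^× ↪ Idl(O)/Idl(ℤ) ≅ 𝒫(primes of N⁺N⁻)`, `x ↦ supp(OxO)`. [cite: Voight2021, Lemma 18.5.1 and Prop. 18.5.3] [cite: VignerasLNM800, Ch. II §2 (normalisateur d'un ordre d'Eichler)] -/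
theorem XiSetup.existsUnique_finset_order_mul_twoSidedIdealProd_eq_units_smul_of_conj_eq {x : S.Dˣ}
    (hx : x • (MulOpposite.op ((x⁻¹ : S.Dˣ) : S.D) • S.O) = S.O) :
    ∃! s : Finset ℕ, s ⊆ (Nplus * Nminus).primeFactors ∧ ∃ (q : ℚ) (y : S.Dˣ), 0 < q ∧
      (y : S.D) = algebraMap ℚ S.D q * x ∧ S.O * S.twoSidedIdealProd S.O (s.sort (· ≤ ·)) = y • S.O := by
  have hO := S.isZOrder_O
  have hN0 : Nplus * Nminus ≠ 0 := mul_ne_zero S.nplus_ne_zero S.squarefree.ne_zero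
  obtain ⟨l, hnd, hl, q, y, hq, hy, h⟩ := S.exists_order_mul_twoSidedIdealProd_eq_units_smul_of_conj_eq hx
  have hsub : l.toFinset ⊆ (Nplus * Nminus).primeFactors := fun r hr => by
    obtain ⟨hp, hd⟩ := hl r (List.mem_toFinset.mp hr)
    exact Nat.mem_primeFactors.mpr ⟨hp, hd, hN0⟩
  refine ⟨l.toFinset, ⟨hsub, q, y, hq, hy, ?_⟩, fun s' ⟨hs', q', y', hq', hy', h'⟩ => ?_⟩
  · rwa [← S.twoSidedIdealProd_perm hO (fun r h => (hl r h).1) (perm_sort_toFinset₆₀ hnd)]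
  · obtain ⟨hl', hnd'⟩ := sort_admissible₆₀ hs'
    have hperm := (S.perm_and_eq_of_order_mul_twoSidedIdealProd_eq_units_smul_of_eq_algebraMap_mul hl' hnd' hl hnd hq' hq hy' hy
      h' h).1
    exact finset_eq_of_perm_sort₆₀ (hperm.trans (perm_sort_toFinset₆₀ hnd))

/-- **THE SUPPORT IS EMPTY IFF `x ∈ ℚ^× O^×`**: for `x ∈ N(O)`, `O P_{[]}(O) = O = (q x) O` for some `q > 0` iff some positive
rational multiple of `x` stabilises `O` (is a unit of `O`) — the kernel of `N(O) → Idl(O)/Idl(ℤ)` is `ℚ^× O^×`.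
[cite: Voight2021, Lemma 18.5.1 (exactness at `N_{B^×}(O)`) and Prop. 18.5.3] -/
theorem XiSetup.order_mul_twoSidedIdealProd_nil_eq_units_smul_iff (y : S.Dˣ) :
    S.O * S.twoSidedIdealProd S.O [] = y • S.O ↔ y ∈ MulAction.stabilizer S.Dˣ S.O := by
  rw [S.twoSidedIdealProd_nil, mul_one, MulAction.mem_stabilizer_iff, eq_comm]

/-- Hence **for `x ∈ N(O)` with `(q x) ∈ O^×` for some `q > 0`, NO non-empty admissible product is generated by a rational
multiple of `x`**: `O P_l(O) ≠ (q' x) O` for `l ≠ []`. [cite: Voight2021, Lemma 18.5.1 and Prop. 18.5.3] -/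
theorem XiSetup.order_mul_twoSidedIdealProd_ne_units_smul_of_mem_stabilizer {x y y' : S.Dˣ} {q q' : ℚ} (hq : 0 < q) (hq' : 0 < q')
    (hy : (y : S.D) = algebraMap ℚ S.D q * x) (hy' : (y' : S.D) = algebraMap ℚ S.D q' * x)
    (hstab : y ∈ MulAction.stabilizer S.Dˣ S.O) {l : List ℕ} (hl : ∀ r ∈ l, r.Prime ∧ r ∣ Nplus * Nminus) (hnd : l.Nodup)
    (hne : l ≠ []) : S.O * S.twoSidedIdealProd S.O l ≠ y' • S.O := by
  intro h'
  have h : S.O * S.twoSidedIdealProd S.O [] = y • S.O := (S.order_mul_twoSidedIdealProd_nil_eq_units_smul_iff y).mpr hstab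
  have hperm := (S.perm_and_eq_of_order_mul_twoSidedIdealProd_eq_units_smul_of_eq_algebraMap_mul (l := []) (by simp)
    List.nodup_nil hl hnd hq hq' hy hy' h h').1
  exact hne (List.Perm.nil_eq hperm).symm

/-! ## §5 The same for every left order `O_L(I)` -/

/-- **Uniqueness of the admissible support at `O_L(I)`**: `k · O_L(I) P_l(O_L(I)) = k' · O_L(I) P_{l'}(O_L(I))` forces `l ~ l'`
and `k = k'`. [cite: Voight2021, (23.4.20) and Lemma 17.4.13] -/
theorem XiSetup.perm_and_eq_of_natCast_smul_leftOrder_mul_twoSidedIdealProd_eq {I : Submodule ℤ S.D} (hI : I ∈ rightIdeals S.O)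
    {l l' : List ℕ} (hl : ∀ r ∈ l, r.Prime ∧ r ∣ Nplus * Nminus) (hnd : l.Nodup)
    (hl' : ∀ r ∈ l', r.Prime ∧ r ∣ Nplus * Nminus) (hnd' : l'.Nodup) {k k' : ℕ} (hk : k ≠ 0) (hk' : k' ≠ 0)
    (h : (k : ℤ) • (leftOrder I * S.twoSidedIdealProd (leftOrder I) l) =
      (k' : ℤ) • (leftOrder I * S.twoSidedIdealProd (leftOrder I) l')) : l.Perm l' ∧ k = k' :=
  (S.ofLeftOrder hI).perm_and_eq_of_natCast_smul_order_mul_twoSidedIdealProd_eq hl hnd hl' hnd' hk hk' h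

/-- **(23.4.20) as a bijection at `O_L(I)`**: every two-sided `O_L(I)`-ideal has a unique admissible support.
[cite: Voight2021, (23.4.20) and Lemma 17.4.13] -/
theorem XiSetup.existsUnique_finset_smul_eq_smul_leftOrder_mul_twoSidedIdealProd {I : Submodule ℤ S.D} (hI : I ∈ rightIdeals S.O)
    {J : Submodule ℤ S.D} (hJ : J ∈ rightIdeals (leftOrder I)) (hJL : leftOrder J = leftOrder I) :
    ∃! s : Finset ℕ, s ⊆ (Nplus * Nminus).primeFactors ∧ ∃ m c : ℕ, m ≠ 0 ∧ c ≠ 0 ∧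
      (m : ℤ) • J = (c : ℤ) • (leftOrder I * S.twoSidedIdealProd (leftOrder I) (s.sort (· ≤ ·))) :=
  (S.ofLeftOrder hI).existsUnique_finset_smul_eq_smul_order_mul_twoSidedIdealProd hJ hJL

/-- **Prop. 18.5.3 at `O_L(I)`**: every `x ∈ N(O_L(I))` has a unique admissible support. [cite: Voight2021, Prop. 18.5.3 and Lemma 17.4.13] -/
theorem XiSetup.existsUnique_finset_leftOrder_mul_twoSidedIdealProd_eq_units_smul_of_conj_eq {I : Submodule ℤ S.D}
    (hI : I ∈ rightIdeals S.O) {x : S.Dˣ} (hx : x • (MulOpposite.op ((x⁻¹ : S.Dˣ) : S.D) • leftOrder I) = leftOrder I) :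
    ∃! s : Finset ℕ, s ⊆ (Nplus * Nminus).primeFactors ∧ ∃ (q : ℚ) (y : S.Dˣ), 0 < q ∧
      (y : S.D) = algebraMap ℚ S.D q * x ∧ leftOrder I * S.twoSidedIdealProd (leftOrder I) (s.sort (· ≤ ·)) = y • leftOrder I :=
  (S.ofLeftOrder hI).existsUnique_finset_order_mul_twoSidedIdealProd_eq_units_smul_of_conj_eq hx

end Brandt

end Literature.NumberTheory.Automorphic
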